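import Literature.Geometry.Lorentzian.TameChartCompactness
import Literature.Geometry.Lorentzian.SpacetimeLocalConvergenceSubseq
import Literature.Geometry.Lorentzian.SpacetimeReverse
import HarnessLib

/-!
# Local Cheeger–Gromov compactness without an orientation hypothesis on the charts

`TameChartCompactness.lean` assumes that the tame charts `Ψₙ` push `∂₀` to the FUTURE at the centre
(then everywhere, by pinching and connectedness). The chart clause of the uniform-tameness
hypotheses of the Final State Conjecture routes (`IsLateChart` + pinching + bounds) carries no
orientation, so a tame chart may push `∂₀` to the past. This file removes the hypothesis: `dΨₙ(∂₀)`
is timelike (pinching), hence future- or past-directed at the centre; infinitely many `n` share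
one alternative (pigeonhole), and along such a subsequence the limit is the near-Minkowski chart
spacetime time-oriented by `∂₀` (`NearMinkowskiChart.spacetime`) or by `−∂₀`
(`NearMinkowskiChart.spacetimeRev`). So:

**Theorem (`Spacetime.exists_nearMinkowskiChart_subconvergesLocallyTo_unoriented`).** Under the
hypotheses of `exists_nearMinkowskiChart_subconvergesLocallyTo` minus the orientation clause, there
are `L : NearMinkowskiChart O`, a strictly increasing `φ` with the `C^∞_loc` convergence of the
deviations to `G − η` and the inherited bounds, and EITHER `(𝓢ₙ, pₙ) ⇀ ((O, G, ∂₀), y₀)` for every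
`k` OR `(𝓢ₙ, pₙ) ⇀ ((O, G, −∂₀), y₀)` for every `k`.

## References
* P. Petersen, *Riemannian Geometry*, 2nd ed., GTM 171, Springer 2006, Ch. 10, §3.2. [Petersen2006]
* B. O'Neill, *Semi-Riemannian geometry*, 1983, Ch. 5, Lemma 5.26 ff. (time cones). [ONeill1983]
-/

noncomputable section

open Set Metric Filter Topology Function TopologicalSpace
open scoped Manifold ContDiff Topology ENNReal

universe u v

namespace Literature.Geometry.Lorentzian

/-! ### The time-reversed near-Minkowski chart spacetime -/

namespace NearMinkowskiChart

variable {O : Opens E4} (L : NearMinkowskiChart O)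

/-- **The near-Minkowski chart spacetime time-oriented by `−∂₀`** (`TimeOrientation.reverse`).
[cite: ONeill1983, Ch. 5, p. 145] -/
def spacetimeRev (hO : IsConnected (O : Set E4)) : Spacetime 4 :=
  letI : ConnectedSpace O := isConnected_iff_connectedSpace.mp hO
  { carrier := O
    metric := L.metric
    timeOrientation := L.timeOrientation.reverse }

variable (hO : IsConnected (O : Set E4))

/-- Its orienting field is `−∂₀`. [folklore] -/
@[simp]
theorem spacetimeRev_vectorField (y : O) :
    (L.spacetimeRev hO).timeOrientation.vectorField y = -(E4.basisVector 0 : E4) := rfl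

/-- Its metric components in its own chart are `G` (same metric as `L.spacetime`). [folklore] -/
theorem metricInCoords_chartAt_symm_rev (x : O) {y : E4} (hy : y ∈ (O : Set E4)) :
    (L.spacetimeRev hO).metricInCoords (chartAt E4 x).symm y = L.G y :=
  L.metricInCoords_chartAt_symm hO x hy

end NearMinkowskiChart

namespace Spacetime

/-! ### The datum for past-oriented charts: limit oriented by `−∂₀` -/

namespace LocalSubconvergence

variable {𝓢ₙ : ℕ → Spacetime.{u} 4} {pₙ : ∀ n, (𝓢ₙ n).carrier} {O : Opens E4}

/-- **The subconvergence datum defined by converging pinched charts pushing `∂₀` to the PAST**,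
with limit the near-Minkowski chart spacetime oriented by `−∂₀` (twin of `ofCharts`).
[cite: Petersen2006, Ch. 10 §3.2] -/
def ofChartsRev (hO : IsConnected (O : Set E4)) {y₀ : E4} (hy₀ : y₀ ∈ (O : Set E4))
    (Ψ : ∀ n, O → (𝓢ₙ n).carrier) (hΨ : ∀ n, ContMDiff 𝓘(ℝ, E4) (𝓡 4) ∞ (Ψ n))
    (hinj : ∀ n, Injective (Ψ n)) (hcentre : ∀ n, Ψ n ⟨y₀, hy₀⟩ = pₙ n)
    (hpast : ∀ n, (𝓢ₙ n).timeOrientation.IsFutureDirected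
      (mfderiv 𝓘(ℝ, E4) (𝓡 4) (Ψ n) ⟨y₀, hy₀⟩ (-(E4.basisVector 0 : E4))))
    (hpinch : ∀ n, ∀ y ∈ (O : Set E4),
      ‖(𝓢ₙ n).deviationExtend (Minkowski.backgroundOn O) (Ψ n) y‖ < 1)
    (L : NearMinkowskiChart O) {φ : ℕ → ℕ} (hφ : StrictMono φ) (k : ℕ)
    (hlim : ∀ K ⊆ (O : Set E4), IsCompact K →
      Tendsto (fun m ↦ supCkENorm K k
        ((𝓢ₙ (φ m)).metricInCoords (Ψ (φ m) ∘ (chartAt E4 (⟨y₀, hy₀⟩ : O)).symm) - L.G))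
        atTop (𝓝 0)) :
    LocalSubconvergence 𝓢ₙ pₙ (L.spacetimeRev hO) ⟨y₀, hy₀⟩ k where
  sub := φ
  strictMono_sub := hφ
  U := reflOpens (L.spacetimeRev hO) ⟨y₀, hy₀⟩
  monotone_U _ _ hmn _ hx :=
    interior_mono ((compactExhaustion (L.spacetimeRev hO)).subset (Nat.add_le_add_right hmn _)) hx
  mem_U := (compactExhaustion (L.spacetimeRev hO)).subset_interior (by omega)
    ((compactExhaustion (L.spacetimeRev hO)).mem_find _)
  iUnion_U := eq_univ_of_forall fun x ↦ mem_iUnion.2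
    ⟨(compactExhaustion (L.spacetimeRev hO)).find x + 1,
      (compactExhaustion (L.spacetimeRev hO)).subset_interior (by omega)
        ((compactExhaustion (L.spacetimeRev hO)).mem_find x)⟩
  isCompact_closure_U _ :=
    ((compactExhaustion (L.spacetimeRev hO)).isCompact _).closure_of_subset interior_subset
  embed m := Ψ (φ m)
  isLocalDiffeomorphOn_embed m :=
    ((𝓢ₙ (φ m)).isLocalDiffeomorph_of_norm_deviationExtend_lt_one (Ψ (φ m)) (hΨ _)
      (hpinch _)).isLocalDiffeomorphOn _
  injOn_embed m := (hinj (φ m)).injOn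
  embed_basepoint m := hcentre (φ m)
  isFutureDirected_mfderiv_embed m x _ := by
    -- apply the one-point orientation lemma to the REVERSED source `(𝓢ₙ (φ m)).reverse`
    have key := (𝓢ₙ (φ m)).reverse.isFutureDirected_mfderiv_basisVector_zero_of_norm_deviationExtend_lt_one
      hO.isPreconnected (Ψ (φ m)) (hΨ _) (hpinch _) (z₁ := ⟨y₀, hy₀⟩)
      (((𝓢ₙ (φ m)).isFutureDirected_reverse_mfderiv_basisVector_iff (Ψ (φ m)) ⟨y₀, hy₀⟩).2
        (hpast (φ m))) x
    exact ((𝓢ₙ (φ m)).isFutureDirected_reverse_mfderiv_basisVector_iff (Ψ (φ m)) x).1 key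
  tendsto_supCkENorm x K hK hKt := by
    have hKO : K ⊆ (O : Set E4) := by
      have h : (chartAt E4 x).target = (O : Set E4) := OpensChart.chartAt_target x
      exact hKt.trans h.subset
    have heq : ∀ m, supCkENorm K k
        ((𝓢ₙ (φ m)).metricInCoords (Ψ (φ m) ∘ (chartAt E4 x).symm) -
          (L.spacetimeRev hO).metricInCoords (chartAt E4 x).symm) =
        supCkENorm K k ((𝓢ₙ (φ m)).metricInCoords (Ψ (φ m) ∘ (chartAt E4 (⟨y₀, hy₀⟩ : O)).symm)
          - L.G) := fun m ↦ by
      refine supCkENorm_congr fun y hy ↦ ?_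
      filter_upwards [O.2.mem_nhds (hKO hy)] with z hz
      have h1 : (L.spacetimeRev hO).metricInCoords (chartAt E4 x).symm z = L.G z :=
        L.metricInCoords_chartAt_symm_rev hO x hz
      show (𝓢ₙ (φ m)).metricInCoords (Ψ (φ m) ∘ (chartAt E4 (⟨y₀, hy₀⟩ : O)).symm) z -
          (L.spacetimeRev hO).metricInCoords (chartAt E4 x).symm z =
        (𝓢ₙ (φ m)).metricInCoords (Ψ (φ m) ∘ (chartAt E4 (⟨y₀, hy₀⟩ : O)).symm) z - L.G z
      rw [h1]
    exact (hlim K hKO hK).congr fun m ↦ (heq m).symm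

end LocalSubconvergence

/-! ### The producer without orientation hypothesis -/

variable {𝓢ₙ : ℕ → Spacetime.{u} 4} {pₙ : ∀ n, (𝓢ₙ n).carrier} {O : Opens E4}

/-- **Local Cheeger–Gromov compactness for uniformly tame pointed spacetimes, no orientation
hypothesis** (module docstring). [cite: Petersen2006, Ch. 10 §3.2] -/
theorem exists_nearMinkowskiChart_subconvergesLocallyTo_unoriented (hO : IsConnected (O : Set E4))
    {y₀ : E4} (hy₀ : y₀ ∈ (O : Set E4)) (Ψ : ∀ n, O → (𝓢ₙ n).carrier)
    (hΨ : ∀ n, ContMDiff 𝓘(ℝ, E4) (𝓡 4) ∞ (Ψ n)) (hinj : ∀ n, Injective (Ψ n))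
    (hcentre : ∀ n, Ψ n ⟨y₀, hy₀⟩ = pₙ n) {θ : ℝ} (hθ : θ < 1)
    (hpinch : ∀ n, ∀ y ∈ (O : Set E4),
      ‖(𝓢ₙ n).deviationExtend (Minkowski.backgroundOn O) (Ψ n) y‖ ≤ θ)
    (hbound : ∀ k : ℕ, ∃ Λ : ℝ≥0∞, Λ ≠ ⊤ ∧
      ∀ n, supCkENorm (O : Set E4) k ((𝓢ₙ n).deviationExtend (Minkowski.backgroundOn O) (Ψ n)) ≤ Λ) :
    ∃ (L : NearMinkowskiChart O) (φ : ℕ → ℕ), StrictMono φ ∧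
      (∀ y ∈ (O : Set E4), ‖L.G y - Minkowski.bilin‖ ≤ θ) ∧
      (∀ (k : ℕ) (C : ℝ≥0∞), (∀ n, supCkENorm (O : Set E4) k
          ((𝓢ₙ n).deviationExtend (Minkowski.backgroundOn O) (Ψ n)) ≤ C) →
        supCkENorm (O : Set E4) k (L.G - fun _ ↦ Minkowski.bilin) ≤ C) ∧
      (∀ (k : ℕ), ∀ K ⊆ (O : Set E4), IsCompact K →
        Tendsto (fun j ↦ supCkENorm K k
          ((𝓢ₙ (φ j)).deviationExtend (Minkowski.backgroundOn O) (Ψ (φ j)) -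
            (L.G - fun _ ↦ Minkowski.bilin))) atTop (𝓝 0)) ∧
      ((∀ k : ℕ, SubconvergesLocallyTo 𝓢ₙ pₙ (L.spacetime hO) ⟨y₀, hy₀⟩ k) ∨
        (∀ k : ℕ, SubconvergesLocallyTo 𝓢ₙ pₙ (L.spacetimeRev hO) ⟨y₀, hy₀⟩ k)) := by
  -- `dΨₙ(∂₀)` is timelike at the centre, hence future- or past-directed
  have hcausal : ∀ n, (𝓢ₙ n).metric.IsCausal
      (mfderiv 𝓘(ℝ, E4) (𝓡 4) (Ψ n) ⟨y₀, hy₀⟩ (E4.basisVector 0)) := by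
    intro n
    have hd : MDifferentiableAt 𝓘(ℝ, E4) (𝓡 4) (Ψ n) ⟨y₀, hy₀⟩ := (hΨ n _).mdifferentiableAt (by simp)
    have hlt := Minkowski.apply_basisVector_zero_neg_of_norm_sub_bilin_lt_one
      (((𝓢ₙ n).norm_metricInCoords_comp_chartAt_symm_sub (Minkowski.backgroundOn O) (Ψ n)
        ⟨y₀, hy₀⟩ (hΨ n) hy₀).trans_lt ((hpinch n y₀ hy₀).trans_lt hθ))
    rw [(𝓢ₙ n).metricInCoords_comp_chartAt_symm_apply (Minkowski.backgroundOn O) (Ψ n) ⟨y₀, hy₀⟩ hy₀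
      hd] at hlt
    exact LorentzianMetric.IsTimelike.isCausal (g := (𝓢ₙ n).metric) hlt
  -- pigeonhole: one alternative holds along a subsequence
  by_cases hfreq : ∃ᶠ n in atTop, (𝓢ₙ n).timeOrientation.IsFutureDirected
      (mfderiv 𝓘(ℝ, E4) (𝓡 4) (Ψ n) ⟨y₀, hy₀⟩ (E4.basisVector 0))
  · obtain ⟨ρ, hρ, hρP⟩ := extraction_of_frequently_atTop hfreq
    obtain ⟨L, φ, hφ, h1, h2, h3, h4⟩ := exists_nearMinkowskiChart_subconvergesLocallyTo
      (𝓢ₙ := fun n ↦ 𝓢ₙ (ρ n)) (pₙ := fun n ↦ pₙ (ρ n)) hO hy₀ (fun n ↦ Ψ (ρ n))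
      (fun n ↦ hΨ (ρ n)) (fun n ↦ hinj (ρ n)) (fun n ↦ hcentre (ρ n)) hρP hθ
      (fun n ↦ hpinch (ρ n)) fun k ↦ (hbound k).imp fun Λ hΛ ↦ ⟨hΛ.1, fun n ↦ hΛ.2 (ρ n)⟩
    refine ⟨L, ρ ∘ φ, hρ.comp hφ, h1, fun k C hC ↦ h2 k C fun n ↦ hC (ρ n), h3, Or.inl fun k ↦ ?_⟩
    exact (h4 k).ofSubseq hρ
  · have hev : ∀ᶠ n in atTop, (𝓢ₙ n).timeOrientation.IsFutureDirected
        (mfderiv 𝓘(ℝ, E4) (𝓡 4) (Ψ n) ⟨y₀, hy₀⟩ (-(E4.basisVector 0 : E4))) := by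
      rw [not_frequently] at hfreq
      filter_upwards [hfreq] with n hn
      rcases (𝓢ₙ n).timeOrientation.isFutureDirected_or_isPastDirected_of_isCausal (hcausal n) with
        h | h
      · exact absurd h hn
      · exact ((𝓢ₙ n).isFutureDirected_mfderiv_neg_basisVector_iff (Ψ n) ⟨y₀, hy₀⟩).2 h
    obtain ⟨ρ, hρ, hρP⟩ := extraction_of_frequently_atTop hev.frequently
    -- run the extraction of `TameChartCompactness` verbatim on the subsequence, then build the
    -- reversed datum (the analytic part does not see the orientation)
    obtain ⟨L, φ, hφ, h1, h2, h3, -⟩ := exists_nearMinkowskiChart_subconvergesLocallyTo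
      (𝓢ₙ := fun n ↦ (𝓢ₙ (ρ n)).reverse) (pₙ := fun n ↦ pₙ (ρ n)) hO hy₀ (fun n ↦ Ψ (ρ n))
      (fun n ↦ hΨ (ρ n)) (fun n ↦ hinj (ρ n)) (fun n ↦ hcentre (ρ n))
      (fun n ↦ ((𝓢ₙ (ρ n)).isFutureDirected_reverse_mfderiv_basisVector_iff (Ψ (ρ n)) ⟨y₀, hy₀⟩).2
        (hρP n))
      hθ (fun n ↦ hpinch (ρ n)) fun k ↦ (hbound k).imp fun Λ hΛ ↦ ⟨hΛ.1, fun n ↦ hΛ.2 (ρ n)⟩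
    refine ⟨L, ρ ∘ φ, hρ.comp hφ, h1, fun k C hC ↦ h2 k C fun n ↦ hC (ρ n), h3, Or.inr fun k ↦ ?_⟩
    refine SubconvergesLocallyTo.ofSubseq hρ ⟨LocalSubconvergence.ofChartsRev hO hy₀
      (𝓢ₙ := fun n ↦ 𝓢ₙ (ρ n)) (pₙ := fun n ↦ pₙ (ρ n)) (fun n ↦ Ψ (ρ n)) (fun n ↦ hΨ (ρ n))
      (fun n ↦ hinj (ρ n)) (fun n ↦ hcentre (ρ n)) hρP
      (fun n y hy ↦ (hpinch (ρ n) y hy).trans_lt hθ) L hφ k fun K hKO hK ↦ ?_⟩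
    exact tendsto_supCkENorm_metricInCoords_sub_of_deviationExtend (𝓢ₙ := fun n ↦ 𝓢ₙ (ρ n))
      (fun n ↦ Ψ (ρ n)) (fun n ↦ hΨ (ρ n)) ⟨y₀, hy₀⟩ L.G hKO (h3 k K hKO hK)

/-- **Local Cheeger–Gromov compactness, Final-State-Conjecture form, no orientation hypothesis**:
pointed spacetimes carrying centred late charts of the Minkowski background on the ball `B(0, r₀)`
with `C⁰` deviation `≤ 1/2` and deviations bounded in every `Cᵏ` uniformly in `n` (the per-point
clause of hypothesis (ii) of the tame final-state routes, at all orders — nothing else) subconverge,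
in the pointed `Cᵏ_loc` sense for every `k`, to the near-Minkowski chart spacetime of the smooth
limit components, time-oriented by `∂₀` or by `−∂₀`. [cite: Petersen2006, Ch. 10 §3.2] -/
theorem exists_nearMinkowskiChart_subconvergesLocallyTo_of_isLateChart_unoriented {r₀ : ℝ}
    (hr₀ : 0 < r₀)
    (Ψ : ∀ n, (⟨Metric.ball (0 : E4) r₀, Metric.isOpen_ball⟩ : Opens E4) → (𝓢ₙ n).carrier)
    {𝒟 : ∀ n, Set (𝓢ₙ n).carrier}
    (hΨ : ∀ n, (𝓢ₙ n).IsLateChart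
      (Minkowski.backgroundOn ⟨Metric.ball (0 : E4) r₀, Metric.isOpen_ball⟩) (𝒟 n) (-r₀) (Ψ n))
    (hcentre : ∀ n, Ψ n ⟨0, Metric.mem_ball_self hr₀⟩ = pₙ n)
    (hpinch : ∀ n, supCkENorm (Metric.ball (0 : E4) r₀) 0 ((𝓢ₙ n).deviationExtend
      (Minkowski.backgroundOn ⟨Metric.ball (0 : E4) r₀, Metric.isOpen_ball⟩) (Ψ n)) ≤ 1 / 2)
    (hbound : ∀ k : ℕ, ∃ Λ : NNReal, ∀ n, supCkENorm (Metric.ball (0 : E4) r₀) k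
      ((𝓢ₙ n).deviationExtend
        (Minkowski.backgroundOn ⟨Metric.ball (0 : E4) r₀, Metric.isOpen_ball⟩) (Ψ n)) ≤ Λ) :
    ∃ (L : NearMinkowskiChart ⟨Metric.ball (0 : E4) r₀, Metric.isOpen_ball⟩) (φ : ℕ → ℕ),
      StrictMono φ ∧
      (∀ y ∈ Metric.ball (0 : E4) r₀, ‖L.G y - Minkowski.bilin‖ ≤ 1 / 2) ∧
      (∀ (k : ℕ) (Λ : NNReal), (∀ n, supCkENorm (Metric.ball (0 : E4) r₀) k
          ((𝓢ₙ n).deviationExtend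
            (Minkowski.backgroundOn ⟨Metric.ball (0 : E4) r₀, Metric.isOpen_ball⟩) (Ψ n)) ≤ Λ) →
        supCkENorm (Metric.ball (0 : E4) r₀) k (L.G - fun _ ↦ Minkowski.bilin) ≤ Λ) ∧
      (∀ (k : ℕ), ∀ K ⊆ Metric.ball (0 : E4) r₀, IsCompact K →
        Tendsto (fun j ↦ supCkENorm K k
          ((𝓢ₙ (φ j)).deviationExtend
              (Minkowski.backgroundOn ⟨Metric.ball (0 : E4) r₀, Metric.isOpen_ball⟩) (Ψ (φ j)) -
            (L.G - fun _ ↦ Minkowski.bilin))) atTop (𝓝 0)) ∧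
      ((∀ k : ℕ, SubconvergesLocallyTo 𝓢ₙ pₙ (L.spacetime (isConnected_ball_E4 hr₀))
          ⟨0, Metric.mem_ball_self hr₀⟩ k) ∨
        (∀ k : ℕ, SubconvergesLocallyTo 𝓢ₙ pₙ (L.spacetimeRev (isConnected_ball_E4 hr₀))
          ⟨0, Metric.mem_ball_self hr₀⟩ k)) := by
  have h12 : ((1 : ℝ≥0∞) / 2).toReal = 1 / 2 := by
    rw [ENNReal.toReal_div]; simp
  obtain ⟨L, φ, hφ, h1, h2, h3, h4⟩ := exists_nearMinkowskiChart_subconvergesLocallyTo_unoriented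
    (isConnected_ball_E4 hr₀) (Metric.mem_ball_self hr₀) Ψ (fun n ↦ (hΨ n).contMDiff)
    (fun n ↦ injective_of_isLateChart_ball (hΨ n)) hcentre (θ := 1 / 2) one_half_lt_one
    (fun n y hy ↦ by
      have h := norm_le_of_supCkENorm_zero_le (by simp) (hpinch n) hy
      rwa [h12] at h)
    fun k ↦ by
      obtain ⟨Λ, hΛ⟩ := hbound k
      exact ⟨Λ, ENNReal.coe_ne_top, hΛ⟩
  exact ⟨L, φ, hφ, h1, fun k Λ hΛ ↦ h2 k Λ hΛ, h3, h4⟩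

end Spacetime

end Literature.Geometry.Lorentzian

end
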